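import Summits.CriticalPhenomena.PercolationContinuityZ3.Theorems.PercNearOneGluingNoHeavyLowerTailSunflowerThreeBlockCombChecker
import HarnessLib
import HarnessLib.Audit

/-!
# `NoHeavyLowerTail` (crux stmt-CriticalPhenomena-4575), abstract sunflower cubic: the THREE-BLOCK theorem III — the compiled check and the
# UNCONDITIONAL three-block partition lemma (rows H, G, T) for every chain composition on three blocks

Support file (seat `prim-ineq-gen-2` gen 21; `--supports stmt-CriticalPhenomena-4575`, `--computational`: ONE compiled evaluation `threeBlockComb_dfs_eq_true` (= `checkAll = true`) by
`native_decide` (axioms standard + its `native_decide` auxiliary), everything else inherits it).  Memo: run/shared/lean/prim/prim-ineq-gen-2/THREEBLOCK-LEAN-GEN21.md.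
EXPECTED elaboration: ≈ 140 s for `threeBlockComb_dfs_eq_true` (1.59·10⁶ search nodes, 595 433 leaves; measured 156 s wall for the whole chain as one file, rc 0).

RESULTS (previously a computation outside Lean, THREEBLOCK-GEN20.md §1; now Lean theorems):
* `comb_height_two` — COMB_chain (`0 ≤ ZFC κ G c` for all classes `c`) for every height-two three-block quotient, `κ ∈ {s6H, s6G, s6T}`;
* `comb_chain_three_blocks_H/G/T` — the same for every three-block quotient of EVERY height (`ChainComb.comb_chain_of_height_two`, p272089);
* **`ZH_composeC_nonneg_three_blocks`**, `ZG_…`, `ZT_…` — the partition lemma ★ (`0 ≤ ZH`, resp. `ZG`, `ZT`) for EVERY sunflower `G.composeC h` reading three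
  disjoint finite blocks through arbitrary monotone chain statistics `h : CGadget β r` of arbitrary heights `r` — equivalently every sunflower on a three-block
  ground set invariant under `S_{E₀} × S_{E₁} × S_{E₂}` read through totally ordered block summaries; contains all cyclic stars `CS(d₁,d₂,d₃)`
  (`…SunflowerCyclicStarPartition`, where both pure payers fail), doubled/tripled stars, products/stars with threshold gadgets.  This is the partition-level
  counterpart of prove-1 g33's law-level three-block theorem `ChainCert.e3_le_max_mul_AG_three_blocks'` and, by cloning, implies the law-level rows
  `H_{q+t}`, `AG⁺`, `T_inc`, `3PT-LB`, `γ` on this family.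
-/

namespace Summit.CriticalPhenomena.PercolationContinuityZ3.Theorems.SunflowerPartition

open Finset

namespace ThreeBlockComb

open ChainComb

/-! ## §1. The computation and the unconditional theorems -/

/-- **THE FINITE CHECK SUCCEEDS**: the depth-first search over all `27` cells from the empty assignment returns `true` (this is `checkAll`, stated unfolded;
compiled evaluation, `Lean.ofReduceBool`). [this work] -/
theorem threeBlockComb_dfs_eq_true : dfs 27 #[] = true := by
  native_decide

/-- **COMB_chain for every height-two three-block quotient**, rows `H`, `G`, `T`. [this work] -/
theorem comb_height_two (G : Sunflower (Σ b : Fin 3, Fin (two (Fin 3) b))) (c : ∀ b : Fin 3, Fin 3 → Fin (two (Fin 3) b + 1)) :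
    0 ≤ ZFC s6H G c ∧ 0 ≤ ZFC s6G G c ∧ 0 ≤ ZFC s6T G c :=
  comb_height_two_of_checkAll threeBlockComb_dfs_eq_true G c

variable {r : Fin 3 → ℕ} {β : Fin 3 → Type*} [∀ b, Fintype (β b)] [∀ b, DecidableEq (β b)]

/-- **COMB_chain for EVERY three-block quotient of every height, row `H`.** [this work] -/
theorem comb_chain_three_blocks_H (G : Sunflower (Σ b, Fin (r b))) : ∀ c : (∀ b, Fin 3 → Fin (r b + 1)), 0 ≤ ZFC s6H G c :=
  comb_chain_of_height_two s6H (fun G' c' => (comb_height_two G' c').1) G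

/-- COMB_chain for every three-block quotient of every height, row `G`. [this work] -/
theorem comb_chain_three_blocks_G (G : Sunflower (Σ b, Fin (r b))) : ∀ c : (∀ b, Fin 3 → Fin (r b + 1)), 0 ≤ ZFC s6G G c :=
  comb_chain_of_height_two s6G (fun G' c' => (comb_height_two G' c').2.1) G

/-- COMB_chain for every three-block quotient of every height, row `T`. [this work] -/
theorem comb_chain_three_blocks_T (G : Sunflower (Σ b, Fin (r b))) : ∀ c : (∀ b, Fin 3 → Fin (r b + 1)), 0 ≤ ZFC s6T G c :=
  comb_chain_of_height_two s6T (fun G' c' => (comb_height_two G' c').2.2) G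

/-- **THE THREE-BLOCK THEOREM, row H**: the partition lemma `0 <= ZH` for EVERY sunflower reading three disjoint blocks through arbitrary
monotone chain statistics (every chain composition `G.composeC h` of every height on three blocks). [this work] -/
theorem ZH_composeC_nonneg_three_blocks (G : Sunflower (Σ b, Fin (r b))) (h : CGadget β r) : 0 ≤ (G.composeC h).ZH :=
  ZH_composeC_nonneg_of_height_two (fun G' c' => (comb_height_two G' c').1) G h

/-- The three-block theorem, row G. [this work] -/
theorem ZG_composeC_nonneg_three_blocks (G : Sunflower (Σ b, Fin (r b))) (h : CGadget β r) : 0 ≤ (G.composeC h).ZG := by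
  rw [Sunflower.ZG_eq_Zp]
  exact Zp_composeC_nonneg_of_height_two s6G (fun G' c' => (comb_height_two G' c').2.1) G h

/-- The three-block theorem, row T. [this work] -/
theorem ZT_composeC_nonneg_three_blocks (G : Sunflower (Σ b, Fin (r b))) (h : CGadget β r) : 0 ≤ (G.composeC h).ZT := by
  rw [Sunflower.ZT_eq_Zp]
  exact Zp_composeC_nonneg_of_height_two s6T (fun G' c' => (comb_height_two G' c').2.2) G h

end ThreeBlockComb

end Summit.CriticalPhenomena.PercolationContinuityZ3.Theorems.SunflowerPartition

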